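import Summits.HodgeConjecture.HodgeConjecture.Theses.EndoscopicMiddleDegree
import Literature.AlgebraicGeometry.HodgeTheory.SupportedHodgeClassDescent
import Literature.AlgebraicGeometry.HodgeTheory.MotivatedClassesAlgebraic
import Literature.AlgebraicTopology.SingularHomology.GysinMapSupportProofs
import Literature.AlgebraicGeometry.Motives.SegreEmbedding
import HarnessLib

/-!
# Transposes of algebraic classes are algebraic (stub `stub_transposeAlgebraic` of line B)

Support file for the crux `IsotypicMiddleClassesAlgebraic` (item `stmt-HodgeConjecture-14301`) of
the route `Summits/HodgeConjecture/HodgeConjecture/Theses/EndoscopicMiddleDegree`, line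
`IdeatorTwoSketch`. For a smooth projective surface `F`, a smooth projective `X` of dimension
`2(m+1)`, an ALGEBRAIC class `Φ ∈ N^{m+2} H^{2(m+2)}((F ⊗ X)(ℂ); ℂ)` and an algebraic divisor class
`y ∈ N¹ H²(F(ℂ); ℂ)`, the "transpose" class `ᵗΦ y := pr_{X*}(pr_F^* y ∪ Φ) ∈ H^{2(m+1)}(X(ℂ); ℂ)` is
algebraic, GRANTED the route's support item `CupProductAlgebraic` (cup products of algebraic
classes are algebraic, Voisin II Prop. 9.20). Three steps, all in the tree:

1. flat pull-back along `pr_F = fst F X` preserves the coniveau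
   (`map_fst_mem_supportedClasses`, Hartshorne III Prop. 9.5);
2. `pr_F^* y ∪ Φ ∈ N^{1+(m+2)}` on `F ⊗ X` — the hypothesis `CupProductAlgebraic` on the smooth
   projective `F ⊗ X` (`IsSmoothProjective.tensor_holds`);
3. the Gysin push-forward `pr_{X*} = complexGysin μ _ _ (snd F X)` of an algebraic class is
   algebraic (`complexGysin_mem_algebraicClasses`, fed with the tree's unconditional
   `gysinMap_restrictCompl_eq_zero_of_field ℂ`).
-/

noncomputable section

-- `Summit.HodgeConjecture.HodgeConjecture.Theorems` is the mandated namespace (single-problem summit),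
-- flagged by `linter.dupNamespace` on every declaration.
set_option linter.dupNamespace false

open CategoryTheory MonoidalCategory CartesianMonoidalCategory
open Literature.AlgebraicGeometry Literature.AlgebraicGeometry.Motives
open Literature.AlgebraicGeometry.HodgeTheory
open Literature.AlgebraicTopology.SingularHomology

namespace Summit.HodgeConjecture.HodgeConjecture.Theorems

/-- Degree bookkeeping for the transpose map `ᵗΦ : H²(F) → H^{2(m+1)}(X)` through `pr_{X*}` on
`F ⊗ X` (`dim (F ⊗ X) = 2 + 2(m+1)`): `a + 2 dim X = b + 2 dim (F ⊗ X)` (private copy of the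
line's `lineB_deg_transpose`; proof-irrelevant). -/
private theorem lineB_deg_transpose (m : ℕ) :
    2 * (1 + (m + 2)) + 2 * (2 * (m + 1)) = 2 * (m + 1) + 2 * (2 + 2 * (m + 1)) := by ring

/-- **Transposes of algebraic classes are algebraic**: for `Φ ∈ N^{m+2}H^{2(m+2)}((F ⊗ X)(ℂ))`
and an algebraic `y ∈ N¹H²(F(ℂ))`, `ᵗΦ y = pr_{X*}(pr_F^* y ∪ Φ) ∈ Nⁿ H^{2n}(X(ℂ))`, `n = m + 1`
(flat pull-back `map_fst_mem_supportedClasses`, cup product of algebraic classes — the route's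
support item `CupProductAlgebraic` on `F ⊗ X` —, Gysin push-forward
`complexGysin_mem_algebraicClasses` with `gysinMap_restrictCompl_eq_zero_of_field ℂ`). -/
theorem stub_transposeAlgebraic (h9 : Theses.EndoscopicMiddleDegree.CupProductAlgebraic)
    (μ : OrientationFamily) (hμ : μ.HasPoincareDuality) (m : ℕ) (X : SchemeOver ℂ)
    (hX : IsSmoothProjective (2 * (m + 1)) X) (F : SchemeOver ℂ) (hF : IsSmoothProjective 2 F)
    (Φ : complexBetti (F ⊗ X) (2 * (m + 2))) (hΦ : Φ ∈ algebraicClasses (F ⊗ X) (m + 2))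
    (y : complexBetti F (2 * 1)) (hy : y ∈ algebraicClasses F 1) :
    complexGysin μ (IsSmoothProjective.tensor_holds hF hX) hX (snd F X) (lineB_deg_transpose m)
      (cupProduct (two_mul_add_two_mul 1 (m + 2)) (complexBetti.map (fst F X) (2 * 1) y) Φ) ∈
      algebraicClasses X (m + 1) :=
  complexGysin_mem_algebraicClasses (gysinMap_restrictCompl_eq_zero_of_field ℂ) μ hμ
    (IsSmoothProjective.tensor_holds hF hX) hX (snd F X) (q := 1 + (m + 2)) (p := m + 1)
    (by omega) (lineB_deg_transpose m)
    (h9 (IsSmoothProjective.tensor_holds hF hX) 1 (m + 2) (complexBetti.map (fst F X) (2 * 1) y) Φ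
      (map_fst_mem_supportedClasses hF hX hy) hΦ)

end Summit.HodgeConjecture.HodgeConjecture.Theorems

end
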